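import Mathlib
import HarnessLib
import Summits.HubbardSuperconductivity.HubbardSuperconductivity.Theorems.KLProgrammeKLRegimeEnginePairTransferStep7AnalyticResolvedConvWPinned2All
import Summits.HubbardSuperconductivity.HubbardSuperconductivity.Theorems.KLProgrammeKLRegimeEnginePairTransferStep7AnalyticResolvedConvWD

/-!
# Route `KLProgramme` — ENGINE item stmt-HubbardSuperconductivity-20437 `KLRegimeEngineV17F2`, class #5 rev 3 — «88b» THE PINNED PAIR (KNOWN-RISK #3 / located-risk #9):
# producer `pairTransferStep7_of_analytic_resolved_convWD_pinned2_all` = `pairTransferStep7_of_analytic_resolved_convWD_all` (the `(x,y)`-difference channel's PH masses discharged as transfer profiles) over the pinned-pair spine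
# (cell gate-hubbard-kl, seat hubbard-kl-k3c1-p1 g17; CLASS5-RESOLVED-STEP.md §17)

WHY.  The pinned-pair spine (…Step7AnalyticResolvedConvKPinned2All) carries, per pair, two extra GUARDED rows — for `1 ≤ n`, `j′ = n+1` and inside the forward windows the SIGNED
direct/crossed `D`-sums in the five-slot scalar form `(Klam U)²·(z·4^{−(n+1)} + h·4^{−(n_β−n)} + w·2⁻ⁿ + l·L⁻¹ + t·min)` (nonneg binders `zD hD wD lD tD zX hX wX lX tX`) — and in `Ran`
the guarded `if [pinned ∧ window] then FIVE-SLOT/((Λₙ−Λₙ₊₁)(βL²)⁻³) else M4²·WD` in place of `M4²·WD₁`, `M4²·WD₂`.  THIS FILE is `pairTransferStep7_of_analytic_resolved_convWD_all` (p660709, S10) re-keyed on that spine: statement =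
the parent's with the ten binders, the nonnegativity + two pinned rows and the guarded `Ran` entries threaded verbatim; proof = the parent's text (the pinned rows pass through).
Plumbing; nothing about the model's sizes is asserted; nothing asserts (X).3, (c), K3 or superconductivity.  0 kit · 0 lit.
-/

noncomputable section

namespace Summit.HubbardSuperconductivity.HubbardSuperconductivity.Theorems.KLRegimeSplit

set_option linter.dupNamespace false -- summit = problem name (single-conjunct summit), D-0017

open Finset Matrix Set Literature.MathematicalPhysics.QuantumLattice Literature.Probability.LatticeModels GrassmannAlgebra
open Literature.MathematicalPhysics.QuantumLattice.FermiRG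
open Summit.HubbardSuperconductivity.HubbardSuperconductivity.Theorems.KLProgrammeCooperResummation
open Summit.HubbardSuperconductivity.HubbardSuperconductivity.Theorems.KLProgrammeLegKernels
open Summit.HubbardSuperconductivity.HubbardSuperconductivity.Theorems.TwoPointAssembly
open Summit.HubbardSuperconductivity.HubbardSuperconductivity.Theorems.DispersionFlow
open Summit.HubbardSuperconductivity.HubbardSuperconductivity.Theorems.KLRegimeWick
open Summit.HubbardSuperconductivity.HubbardSuperconductivity.Theorems.EngineV8

section ProducerAll

set_option maxHeartbeats 3200000 in -- long binder lists ×3 + the analytic bundle; plumbing into `pairTransferStep7_of_private`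
/-- **`pairTransferStep7_of_analytic_resolved_convWD_pinned2_all`** — «88b» pinned-pair twin (module docstring). -/
theorem pairTransferStep7_of_analytic_resolved_convWD_pinned2_all (C : ∀ L : ℕ, TorusSite 2 L → ℕ → Prop) (hC : ∀ (L : ℕ) (Qm : TorusSite 2 L) (j n : ℕ), j ≤ n → C L Qm n → C L Qm j) {P : SplitConsts} {R : RenConsts} {Q₀ : EngConsts} {G Gth : GeoConsts} {r θ : ℝ} {u : EngConsts → ℝ → ℝ} (mA : ℝ → ℝ) (hR : R.WF2) (hCF : 0 ≤ Gth.CF) (hKl : 0 ≤ P.Klam) (hr : 0 ≤ r) (hθ0 : 0 ≤ θ) (hθ : θ ≤ 1 / 5)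
    (h0 : ∀ (U μ β : ℝ), μ ∈ klWindowC → FrameOK R U (nScales β) μ 0) (hmA : ∀ (Q : EngConsts) (cc U : ℝ), 0 < U → U ≤ u Q cc → 0 ≤ mA U ∧ mA U * ((2 : ℝ) ^ 10 * 15367) ≤ 1 / 3) {A2s : ℝ} {u2s : RenConsts → ℝ} (h2s : TwoShellFrameAreaAt A2s u2s) (hA2s : 0 ≤ A2s)
    -- the conv lemmas' regime side conditions, asked IN THE LOOP'S CONTEXT («hkit»; the band condition only for `1 ≤ n`; `U ≤ u2s R` is the package threshold's to grant)
    (hkit : G.WF → ∀ Q : EngConsts, Q₀.IsRaiseOf Q → ∀ cc : ℝ, 0 < cc → cc ≤ klEngC₃6 P R → ∀ μ ∈ klWindowC, ∀ U : ℝ, 0 < U → U ≤ klEngU₀10 P R cc → U ≤ u Q cc → ∀ β : ℝ, klBetaMin ≤ β → β ≤ Real.exp (cc / U ^ 2) → ∀ (L M : ℕ) [NeZero L] [NeZero M], klEngL₄ P R β U ≤ L → klEngM₃ β U L ≤ M → ∀ n : ℕ, n + 1 ≤ nScales β + 1 → IsKLRegime U cc (-((n + 1 : ℕ) : ℤ))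 →
      U ≤ u2s R ∧ Real.pi / (4 * β) ≤ klScale klE0 (n + 1) ∧ (4 + 8 / 3 * R.Gfr 1 * U ^ 2) * (2 * Real.pi / L) ≤ klScale klE0 (n + 1) ∧ (1 ≤ n → 2 * klScale klE0 n + (4 + 8 / 3 * R.Gfr 1 * U ^ 2) * (2 * Real.pi / L) ≤ klE0)) (hbase : G.WF → ∀ Q : EngConsts, Q₀.IsRaiseOf Q → ∀ cc : ℝ, 0 < cc → cc ≤ klEngC₃6 P R → ∀ μ ∈ klWindowC, ∀ U : ℝ, 0 < U → U ≤ klEngU₀10 P R cc → U ≤ u Q cc →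
          ∀ β : ℝ, klBetaMin ≤ β → β ≤ Real.exp (cc / U ^ 2) → ∀ (L M : ℕ) [NeZero L] [NeZero M], klEngL₄ P R β U ≤ L → klEngM₃ β U L ≤ M → 0 ≤ nScales β + 1 → IsKLRegime U cc (-((0 : ℕ) : ℤ)) → HistP klPredsV17F2 L M G P Q R β U μ 0 0 → FrameOK R U (nScales β) μ (klFlowFrameU L M β U μ 0) → (∀ j ≤ 0, LevelsUExportMixedAt L M (klCU2 P R Q₀) P β U μ j) →
      ∀ j j' : ℕ, 0 ≤ j' → j' ≤ j → j ≤ nScales β + 1 → ∀ Qm : TorusSite 2 L, C L Qm 0 →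
      -- BASE CLOSED at scale 0 (k3c1-p1 g14 rows 52/52b `klmg_memberAmplitude_sub_le_sq` / `klmf_baseData_of_scaleZero`; regime rows from the thresholds): the two a priori rows
      -- [class #1] and ONE scalar inequality of the depth `j′` (`klTransferC R` = k3c2-p1 g5's closed scale-0 transfer constant)
      (∀ x y, ‖klMemberArrayF L M β U μ 0 (softSymbolCompl L M β μ (klFlowFrameU L M β U μ 0) 0 j) Qm x y‖ ≤ mA U) ∧ (∀ x y, ‖klMemberArrayF L M β U μ 0 (softSymbolCompl L M β μ (klFlowFrameU L M β U μ 0) 0 j') Qm x y‖ ≤ mA U) ∧ 4 / 6047 * klIdxMass 0 j' * (klTransferC R * U ^ 2) + 4 * (mA U * mA U) * klIdxMass 0 j' ≤ θ * (r * ((P.Klam * U) ^ 2 * klIdxMass 0 j'))) (hsucc : G.WF → ∀ Q : EngConsts, Q₀.IsRaiseOf Q →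
      ∀ cc : ℝ, 0 < cc → cc ≤ klEngC₃6 P R → ∀ μ ∈ klWindowC, ∀ U : ℝ, 0 < U → U ≤ klEngU₀10 P R cc → U ≤ u Q cc → ∀ β : ℝ, klBetaMin ≤ β → β ≤ Real.exp (cc / U ^ 2) → ∀ (L M : ℕ) [NeZero L] [NeZero M], klEngL₄ P R β U ≤ L → klEngM₃ β U L ≤ M → ∀ n : ℕ, n + 1 ≤ nScales β + 1 → IsKLRegime U cc (-((n + 1 : ℕ) : ℤ)) → HistP klPredsV17F2 L M G P Q R β U μ 0 (n + 1) →
                  FrameOK R U (nScales β) μ (klFlowFrameU L M β U μ (n + 1)) → (∀ j ≤ n + 1, LevelsUExportMixedAt L M (klCU2 P R Q₀) P β U μ j) → (∀ Λ ∈ Icc (klScale klE0 (n + 1)) (klScale klE0 n), hubbardEffPartitionFnCT L M β U μ 0 (klFlowFrameU L M β U μ (n + 1)) Λ ≠ 0) ∧ ∀ (A A' : ℕ → TorusSite 2 L → ℝ → Matrix (TorusSite 2 L) (TorusSite 2 L) ℂ) (b b' : ℕ → TorusSite 2 L → ℝ → TorusSite 2 L → ℂ)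
        (a : ℕ → ℕ → TorusSite 2 L → ℝ → TorusSite 2 L → ℂ) (ρ : ℕ → TorusSite 2 L → TorusSite 2 L → ℝ) (V : ℕ → ℝ → (Fin 4 → HubbardFieldIdx L M) → ℂ) (V6 : ℕ → ℝ → (Fin 6 → HubbardFieldIdx L M) → ℂ) (Sg : ℕ → ℝ → FreqMomentum L M → Fin 2 → ℂ) (Hd : ℕ → ℝ → (Fin 4 → HubbardFieldIdx L M) → ℂ) (Φ : ℕ → ℝ → FreqMomentum L M → ℝ) (Wd : ℝ →
                FreqMomentum L M → ℝ) (Br : ℕ → TorusSite 2 L → ℝ → TorusSite 2 L × MatsubaraIdx M → ℂ), (A = fun j Qm t => Matrix.of fun k k' : TorusSite 2 L => if k ∈ klBall L μ 0 ∧ k' ∈ klBall L μ 0 then vertexFn L M β (gaussConv ℂ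
        (softCovOf L M β μ (klFlowFrameU L M β U μ (n + 1)) (softSymbolCompl L M β μ (klFlowFrameU L M β U μ (n + 1)) (n + 1) j) + hubbardCovAboveCT L M β μ 0 (klFlowFrameU L M β U μ (n + 1)) (klScale klE0 (n + 1)) - hubbardCovAboveCT L M β μ 0 (klFlowFrameU L M β U μ (n + 1)) (klScale klE0 n + t * (klScale klE0 (n + 1) - klScale klE0 n)))
        (hubbardEffectiveActionCT L M β U μ 0 (klFlowFrameU L M β U μ (n + 1)) (klScale klE0 n + t * (klScale klE0 (n + 1) - klScale klE0 n)))) 4 ![(((omega0 M, k'), 0), 0), ((((omega0 M).rev, Qm - k'), 1), 0), ((((omega0 M).rev, Qm - k), 1), 1), (((omega0 M, k), 0), 1)] else 0) → (A' = fun j Qm t => Matrix.of fun k k' : TorusSite 2 L => if k ∈ klBall L μ 0 ∧ k' ∈ klBall L μ 0 then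
      (klScale klE0 (n + 1) - klScale klE0 n) • -((2 : ℂ)⁻¹ * vertexFn L M β (gaussConv ℂ (softCovOf L M β μ (klFlowFrameU L M β U μ (n + 1)) (softSymbolCompl L M β μ (klFlowFrameU L M β U μ (n + 1)) (n + 1) j) + hubbardCovAboveCT L M β μ 0 (klFlowFrameU L M β U μ (n + 1)) (klScale klE0 (n + 1)) -
          hubbardCovAboveCT L M β μ 0 (klFlowFrameU L M β U μ (n + 1)) (klScale klE0 n + t * (klScale klE0 (n + 1) - klScale klE0 n))) (grassmannDerivPairing ℂ (Matrix.of fun X Y : HubbardFieldIdx L M => deriv (fun Λ'' : ℝ => hubbardCovAboveCT L M β μ 0 (klFlowFrameU L M β U μ (n + 1)) Λ'' X Y) (klScale klE0 n + t * (klScale klE0 (n + 1) - klScale klE0 n)))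
          (hubbardEffectiveActionCT L M β U μ 0 (klFlowFrameU L M β U μ (n + 1)) (klScale klE0 n + t * (klScale klE0 (n + 1) - klScale klE0 n))) (hubbardEffectiveActionCT L M β U μ 0 (klFlowFrameU L M β U μ (n + 1)) (klScale klE0 n + t * (klScale klE0 (n + 1) - klScale klE0 n))))) 4 ![(((omega0 M, k'), 0), 0), ((((omega0 M).rev, Qm - k'), 1), 0), ((((omega0 M).rev, Qm - k), 1), 1), (((omega0 M, k), 0), 1)]) else 0) →
        (b = fun j Qm t p => -((klBubbleMass L M β μ (klFlowFrameU L M β U μ (n + 1)) (fun k => (softSymbolCompl L M β μ (klFlowFrameU L M β U μ (n + 1)) (n + 1) j) k + (hubbardCutoffWeightCT L M β μ (klFlowFrameU L M β U μ (n + 1)) (klScale klE0 (n + 1)) k - hubbardCutoffWeightCT L M β μ (klFlowFrameU L M β U μ (n + 1)) (klScale klE0 n + t * (klScale klE0 (n + 1) - klScale klE0 n)) k))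
        (fun k => (softSymbolCompl L M β μ (klFlowFrameU L M β U μ (n + 1)) (n + 1) j) k + (hubbardCutoffWeightCT L M β μ (klFlowFrameU L M β U μ (n + 1)) (klScale klE0 (n + 1)) k - hubbardCutoffWeightCT L M β μ (klFlowFrameU L M β U μ (n + 1)) (klScale klE0 n + t * (klScale klE0 (n + 1) - klScale klE0 n)) k)) Qm p : ℝ) : ℂ)) → (b' = fun j Qm t p => (((klScale klE0 (n + 1) - klScale klE0 n) *
        (klBubbleMass L M β μ (klFlowFrameU L M β U μ (n + 1)) (fun k => deriv (fun Λ' => hubbardCutoffWeightCT L M β μ (klFlowFrameU L M β U μ (n + 1)) Λ' k) (klScale klE0 n + t * (klScale klE0 (n + 1) - klScale klE0 n))) (fun k => (softSymbolCompl L M β μ (klFlowFrameU L M β U μ (n + 1)) (n + 1) j) k + (hubbardCutoffWeightCT L M β μ (klFlowFrameU L M β U μ (n + 1)) (klScale klE0 (n + 1)) k -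
          hubbardCutoffWeightCT L M β μ (klFlowFrameU L M β U μ (n + 1)) (klScale klE0 n + t * (klScale klE0 (n + 1) - klScale klE0 n)) k)) Qm p + klBubbleMass L M β μ (klFlowFrameU L M β U μ (n + 1)) (fun k => (softSymbolCompl L M β μ (klFlowFrameU L M β U μ (n + 1)) (n + 1) j) k + (hubbardCutoffWeightCT L M β μ (klFlowFrameU L M β U μ (n + 1)) (klScale klE0 (n + 1)) k -
          hubbardCutoffWeightCT L M β μ (klFlowFrameU L M β U μ (n + 1)) (klScale klE0 n + t * (klScale klE0 (n + 1) - klScale klE0 n)) k)) (fun k => deriv (fun Λ' => hubbardCutoffWeightCT L M β μ (klFlowFrameU L M β U μ (n + 1)) Λ' k) (klScale klE0 n + t * (klScale klE0 (n + 1) - klScale klE0 n))) Qm p) : ℝ) : ℂ)) → (a = fun j j' Qm t p => (b j Qm t p - b j' Qm t p) +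
      (-(((klTransferWeight L M β μ (klFlowFrameU L M β U μ (n + 1)) (n + 1) (softSymbolCompl L M β μ (klFlowFrameU L M β U μ (n + 1)) (n + 1) j) Qm p - klTransferWeight L M β μ (klFlowFrameU L M β U μ (n + 1)) (n + 1) (softSymbolCompl L M β μ (klFlowFrameU L M β U μ (n + 1)) (n + 1) j') Qm p : ℝ)) : ℂ) - (b j Qm 1 p - b j' Qm 1 p))) →
        (ρ = fun j Qm c => klRungProfile L M β μ (klFlowFrameU L M β U μ (n + 1)) n (softSymbolCompl L M β μ (klFlowFrameU L M β U μ (n + 1)) (n + 1) j) Qm c) → (V = fun j t X => vertexFn L M β (gaussConv ℂ (softCovOf L M β μ (klFlowFrameU L M β U μ (n + 1)) (softSymbolCompl L M β μ (klFlowFrameU L M β U μ (n + 1)) (n + 1) j) + hubbardCovAboveCT L M β μ 0 (klFlowFrameU L M β U μ (n + 1)) (klScale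
                klE0 (n + 1)) - hubbardCovAboveCT L M β μ 0 (klFlowFrameU L M β U μ (n + 1)) (klScale klE0 n + t * (klScale klE0 (n + 1) - klScale klE0 n))) (hubbardEffectiveActionCT L M β U μ 0 (klFlowFrameU L M β U μ (n + 1)) (klScale klE0 n + t * (klScale klE0 (n + 1) - klScale klE0 n)))) 4 X) →
        (V6 = fun j t X => vertexFn L M β (gaussConv ℂ (softCovOf L M β μ (klFlowFrameU L M β U μ (n + 1)) (softSymbolCompl L M β μ (klFlowFrameU L M β U μ (n + 1)) (n + 1) j) + hubbardCovAboveCT L M β μ 0 (klFlowFrameU L M β U μ (n + 1)) (klScale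
                klE0 (n + 1)) - hubbardCovAboveCT L M β μ 0 (klFlowFrameU L M β U μ (n + 1)) (klScale klE0 n + t * (klScale klE0 (n + 1) - klScale klE0 n))) (hubbardEffectiveActionCT L M β U μ 0 (klFlowFrameU L M β U μ (n + 1)) (klScale klE0 n + t * (klScale klE0 (n + 1) - klScale klE0 n)))) 6 X) →
        (Sg = fun j t p σ => selfEnergy L M β (gaussConv ℂ (softCovOf L M β μ (klFlowFrameU L M β U μ (n + 1)) (softSymbolCompl L M β μ (klFlowFrameU L M β U μ (n + 1)) (n + 1) j) + hubbardCovAboveCT L M β μ 0 (klFlowFrameU L M β U μ (n + 1))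
                (klScale klE0 (n + 1)) - hubbardCovAboveCT L M β μ 0 (klFlowFrameU L M β U μ (n + 1)) (klScale klE0 n + t * (klScale klE0 (n + 1) - klScale klE0 n))) (hubbardEffectiveActionCT L M β U μ 0 (klFlowFrameU L M β U μ (n + 1)) (klScale klE0 n + t * (klScale klE0 (n + 1) - klScale klE0 n)))) p σ) →
        (Hd = fun j t X => vertexFn L M β (dblFold ℂ (grassmannLaplacian ℂ (crossCov ℂ (Matrix.of fun X Y : HubbardFieldIdx L M => deriv (fun Λ' : ℝ => hubbardCovAboveCT L M β μ 0 (klFlowFrameU L M β U μ (n + 1)) Λ' X Y) (klScale klE0 n + t *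
                (klScale klE0 (n + 1) - klScale klE0 n)))) ((gaussConv ℂ (crossCov ℂ (softCovOf L M β μ (klFlowFrameU L M β U μ (n + 1)) (softSymbolCompl L M β μ (klFlowFrameU L M β U μ (n + 1)) (n + 1) j) + hubbardCovAboveCT L M β μ 0 (klFlowFrameU
                L M β U μ (n + 1)) (klScale klE0 (n + 1)) - hubbardCovAboveCT L M β μ 0 (klFlowFrameU L M β U μ (n + 1)) (klScale klE0 n + t * (klScale klE0 (n + 1) - klScale klE0 n)))) - grassmannLaplacian ℂ (crossCov ℂ (softCovOf L M β μ
                (klFlowFrameU L M β U μ (n + 1)) (softSymbolCompl L M β μ (klFlowFrameU L M β U μ (n + 1)) (n + 1) j) + hubbardCovAboveCT L M β μ 0 (klFlowFrameU L M β U μ (n + 1)) (klScale klE0 (n + 1)) - hubbardCovAboveCT L M β μ 0 (klFlowFrameU L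
                M β U μ (n + 1)) (klScale klE0 n + t * (klScale klE0 (n + 1) - klScale klE0 n))))) (dblCopy ℂ 0 (gaussConv ℂ (softCovOf L M β μ (klFlowFrameU L M β U μ (n + 1)) (softSymbolCompl L M β μ (klFlowFrameU L M β U μ (n + 1)) (n + 1) j) +
                hubbardCovAboveCT L M β μ 0 (klFlowFrameU L M β U μ (n + 1)) (klScale klE0 (n + 1)) - hubbardCovAboveCT L M β μ 0 (klFlowFrameU L M β U μ (n + 1)) (klScale klE0 n + t * (klScale klE0 (n + 1) - klScale klE0 n)))
                (hubbardEffectiveActionCT L M β U μ 0 (klFlowFrameU L M β U μ (n + 1)) (klScale klE0 n + t * (klScale klE0 (n + 1) - klScale klE0 n)))) * dblCopy ℂ 1 (gaussConv ℂ (softCovOf L M β μ (klFlowFrameU L M β U μ (n + 1)) (softSymbolCompl L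
                M β μ (klFlowFrameU L M β U μ (n + 1)) (n + 1) j) + hubbardCovAboveCT L M β μ 0 (klFlowFrameU L M β U μ (n + 1)) (klScale klE0 (n + 1)) - hubbardCovAboveCT L M β μ 0 (klFlowFrameU L M β U μ (n + 1)) (klScale klE0 n + t * (klScale
                klE0 (n + 1) - klScale klE0 n))) (hubbardEffectiveActionCT L M β U μ 0 (klFlowFrameU L M β U μ (n + 1)) (klScale klE0 n + t * (klScale klE0 (n + 1) - klScale klE0 n)))))))) 4 X) →
        (Φ = fun j t k => (softSymbolCompl L M β μ (klFlowFrameU L M β U μ (n + 1)) (n + 1) j) k + (hubbardCutoffWeightCT L M β μ (klFlowFrameU L M β U μ (n + 1)) (klScale klE0 (n + 1)) k - hubbardCutoffWeightCT L M β μ (klFlowFrameU L M β U μ (n + 1)) (klScale klE0 n + t * (klScale klE0 (n + 1) - klScale klE0 n)) k)) →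
        (Wd = fun t k => deriv (fun Λ' : ℝ => hubbardCutoffWeightCT L M β μ (klFlowFrameU L M β U μ (n + 1)) Λ' k) (klScale klE0 n + t * (klScale klE0 (n + 1) - klScale klE0 n))) → (Br = fun j Qm t z => -(((((β * (L : ℝ) ^ 2 : ℝ) : ℂ)))⁻¹ * propCT L M β μ (klFlowFrameU L M β U μ (n + 1)) (z.2, z.1) * propCT L M β μ (klFlowFrameU L M β U μ (n + 1)) (z.2.rev, Qm - z.1)) *
      ((((klScale klE0 (n + 1) - klScale klE0 n) * (-Wd t (z.2, z.1) * Φ j t (z.2.rev, Qm - z.1) - Φ j t (z.2, z.1) * Wd t (z.2.rev, Qm - z.1))) : ℝ) : ℂ)) → ∀ j j' : ℕ, n + 1 ≤ j' → j' ≤ j → j ≤ nScales β + 1 → ∀ Qm : TorusSite 2 L, C L Qm (n + 1) → ∃ (ηr η₁ η₂ R₀ Ran : TorusSite 2 L → TorusSite 2 L → ℝ) (d : TorusSite 2 L → ℝ) (M4 M6 M2 η4 η6 η2 zD hD wD lD tD zX hX wX lX tX bP : ℝ) (Ish : ℕ)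
        (RH₁ RH₂ Rhd W6₁ W6₂ WD₁ WD₂ WD₃ RL₁ RL₂ Rl₁ Rl₂ : TorusSite 2 L → TorusSite 2 L → ℝ), (∀ t ∈ Icc (0 : ℝ) 1, ∀ x y, ‖A j Qm t x y‖ ≤ mA U) ∧ (∀ t ∈ Icc (0 : ℝ) 1, ∀ x y, ‖A j' Qm t x y‖ ≤ mA U) ∧
        -- ANALYTIC INPUTS of the STEP's defect rows in MASSES form: kernel sups [class #1], smearing numbers [binomial–Gram], ≥ 2 cross lines rows,
        -- weight masses [k3c2-p2] — ALL member PH masses are DISCHARGED (convolved: rows 66∪/69; `(x,y)`-difference channel: as profiles in the transfer, this file) —,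
        -- localisation rows [(c) closer]
        0 ≤ M4 ∧ (0 ≤ zD ∧ 0 ≤ hD ∧ 0 ≤ wD ∧ 0 ≤ lD ∧ 0 ≤ tD ∧ 0 ≤ zX ∧ 0 ≤ hX ∧ 0 ≤ wX ∧ 0 ≤ lX ∧ 0 ≤ tX ∧ 0 ≤ bP) ∧
        -- «88b» THE PINNED PAIR (`1 ≤ n`, `j′ = n+1`): the SIGNED direct/crossed `D`-rows in the forward windows, five-slot scalar form (binders `zD … tX`; split3 door ∘ slots)
        (1 ≤ n → j' = n + 1 → ∀ t ∈ Icc (0 : ℝ) 1, ∀ x y : TorusSite 2 L, (4 + 8 / 3 * R.Gfr 1 * U ^ 2) * klTorusNorm L (x - y) < klScale klE0 (n + 1) / 8 → ((klScale klE0 n - klScale klE0 (n + 1)) * ((β * (L : ℝ) ^ 2) ^ 3)⁻¹) * ‖(∑ p : FreqMomentum L M, ∑ σ : Fin 2, ∑ p' : FreqMomentum L M, if matsubaraInt M p'.1 + matsubaraInt M (omega0 M) = matsubaraInt M p.1 + matsubaraInt M (omega0 M) ∧ p'.2 = p.2 + x - y then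
              ((((((((softSymbolCompl L M β μ (klFlowFrameU L M β U μ (n + 1)) (n + 1) j) p - (softSymbolCompl L M β μ (klFlowFrameU L M β U μ (n + 1)) (n + 1) j') p)) : ℝ) : ℂ) * (((β * (L : ℝ) ^ 2 : ℝ) : ℂ) * propCT L M β μ (klFlowFrameU L M β U μ (n + 1)) p)) * ((((Wd t p') : ℝ) : ℂ) * (((β * (L : ℝ) ^ 2 : ℝ) : ℂ) * propCT L M β μ
                      (klFlowFrameU L M β U μ (n + 1)) p'))) + (((((Wd t p) : ℝ) : ℂ) * (((β * (L : ℝ) ^ 2 : ℝ) : ℂ) * propCT L M β μ (klFlowFrameU L M β U μ (n + 1)) p)) * ((((((softSymbolCompl L M β μ (klFlowFrameU L M β U μ (n + 1)) (n + 1) j) p' - (softSymbolCompl L M β μ (klFlowFrameU L M β U μ (n + 1)) (n + 1) j') p')) : ℝ) :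
                      ℂ) * (((β * (L : ℝ) ^ 2 : ℝ) : ℂ) * propCT L M β μ (klFlowFrameU L M β U μ (n + 1)) p')))) * (V j t ![((p, σ), 1), ((p', σ), 0), (((omega0 M, y), 0), 0), (((omega0 M, x), 0), 1)] * V j t ![((p, σ), 0), ((p', σ), 1), ((((omega0 M).rev, Qm - y), 1), 0), ((((omega0 M).rev, Qm - x), 1), 1)]) else 0)‖ ≤
          (P.Klam * U) ^ 2 * (zD * ((4 : ℝ) ^ (n + 1))⁻¹ + hD * ((4 : ℝ) ^ (nScales β - n))⁻¹ + wD * ((2 : ℝ) ^ n)⁻¹ + lD * ((L : ℝ))⁻¹ + tD * min (klTorusNorm L (x - y) / klScale klE0 (n + 1)) (klScale klE0 (n + 1) / klTorusNorm L (x - y)))) ∧ (1 ≤ n → j' = n + 1 → n + 3 ≤ nScales β → ∀ t ∈ Icc (0 : ℝ) 1, ∀ x y : TorusSite 2 L, (4 + 8 / 3 * R.Gfr 1 * U ^ 2) * klTorusNorm L (x + y - Qm) < klScale klE0 (n + 1) / 16 →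
          ((klScale klE0 n - klScale klE0 (n + 1)) * ((β * (L : ℝ) ^ 2) ^ 3)⁻¹) * ‖(∑ p : FreqMomentum L M, ∑ p' : FreqMomentum L M, if matsubaraInt M p'.1 + matsubaraInt M (omega0 M) + matsubaraInt M (omega0 M) + 1 = matsubaraInt M p.1 ∧ p'.2 = p.2 + Qm - x - y then
              ((((((((softSymbolCompl L M β μ (klFlowFrameU L M β U μ (n + 1)) (n + 1) j) p - (softSymbolCompl L M β μ (klFlowFrameU L M β U μ (n + 1)) (n + 1) j') p)) : ℝ) : ℂ) * (((β * (L : ℝ) ^ 2 : ℝ) : ℂ) * propCT L M β μ (klFlowFrameU L M β U μ (n + 1)) p)) * ((((Wd t p') : ℝ) : ℂ) * (((β * (L : ℝ) ^ 2 : ℝ) : ℂ) * propCT L M β μ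
                      (klFlowFrameU L M β U μ (n + 1)) p'))) + (((((Wd t p) : ℝ) : ℂ) * (((β * (L : ℝ) ^ 2 : ℝ) : ℂ) * propCT L M β μ (klFlowFrameU L M β U μ (n + 1)) p)) * ((((((softSymbolCompl L M β μ (klFlowFrameU L M β U μ (n + 1)) (n + 1) j) p' - (softSymbolCompl L M β μ (klFlowFrameU L M β U μ (n + 1)) (n + 1) j') p')) : ℝ) :
                      ℂ) * (((β * (L : ℝ) ^ 2 : ℝ) : ℂ) * propCT L M β μ (klFlowFrameU L M β U μ (n + 1)) p')))) * (V j t ![((p, 0), 1), ((p', 1), 0), (((omega0 M, y), 0), 0), ((((omega0 M).rev, Qm - x), 1), 1)] * V j t ![((p, 0), 0), ((p', 1), 1), ((((omega0 M).rev, Qm - y), 1), 0), (((omega0 M, x), 0), 1)]) else 0)‖ ≤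
          (P.Klam * U) ^ 2 * (zX * ((4 : ℝ) ^ (n + 1))⁻¹ + hX * ((4 : ℝ) ^ (nScales β - n))⁻¹ + wX * ((2 : ℝ) ^ n)⁻¹ + lX * ((L : ℝ))⁻¹ + tX * min (klTorusNorm L (x + y - Qm) / klScale klE0 (n + 1)) (klScale klE0 (n + 1) / klTorusNorm L (x + y - Qm)))) ∧
        -- «88b» v2 (#15): the SIGNED born `D`-row at the pinned pair keyed to a free number `bP` in the overlap slot's shape (class #1's `TwoLegSlopes`/`KernelNormsV3` currency)
        (1 ≤ n → j' = n + 1 → ∀ t ∈ Icc (0 : ℝ) 1, ∀ x y : TorusSite 2 L,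
          ((klScale klE0 n - klScale klE0 (n + 1)) * ((β * (L : ℝ) ^ 2) ^ 3)⁻¹) *
            ‖(∑ p : FreqMomentum L M, ∑ σ : Fin 2,
            (((((Wd t p) : ℝ) : ℂ) * (((β * (L : ℝ) ^ 2 : ℝ) : ℂ) * propCT L M β μ (klFlowFrameU L M β U μ (n + 1)) p)) * ((((((softSymbolCompl L M β μ (klFlowFrameU L M β U μ (n + 1))
                    (n + 1) j) p - (softSymbolCompl L M β μ (klFlowFrameU L M β U μ (n + 1)) (n + 1) j') p)) : ℝ) : ℂ) * (((β * (L : ℝ) ^ 2 : ℝ) : ℂ) * propCT L M β μ (klFlowFrameU L M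
                    β U μ (n + 1)) p))) *
              (V6 j t ![((p, σ), 0), ((p, σ), 1), (((omega0 M, y), 0), 0), ((((omega0 M).rev, Qm - y), 1), 0), ((((omega0 M).rev, Qm - x), 1), 1),
                (((omega0 M, x), 0), 1)] *
                Sg j t p σ))‖ ≤
          (P.Klam * U) ^ 2 * bP * ((4 : ℝ) ^ (n + 1))⁻¹) ∧ (∀ t ∈ Icc (0 : ℝ) 1, ∀ X, ‖V j t X‖ ≤ M4) ∧ (∀ t ∈ Icc (0 : ℝ) 1, ∀ X, ‖V j' t X‖ ≤ M4) ∧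
        (∀ t ∈ Icc (0 : ℝ) 1, ∀ X, ‖V6 j t X‖ ≤ M6) ∧ (∀ t ∈ Icc (0 : ℝ) 1, ∀ X, ‖V6 j' t X‖ ≤ M6) ∧ (∀ t ∈ Icc (0 : ℝ) 1, ∀ p σ, ‖Sg j t p σ‖ ≤ M2) ∧ (∀ t ∈ Icc (0 : ℝ) 1, ∀ p σ, ‖Sg j' t p σ‖ ≤ M2) ∧ (∀ t ∈ Icc (0 : ℝ) 1, ∀ X, ‖V j t X - V j' t X‖ ≤ η4) ∧ (∀ t ∈ Icc (0 : ℝ) 1, ∀ X, ‖V6 j t X - V6 j' t X‖ ≤ η6) ∧ (∀ t ∈ Icc (0 : ℝ) 1, ∀ p σ, ‖Sg j t p σ - Sg j' t p σ‖ ≤ η2) ∧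
        (∀ t ∈ Icc (0 : ℝ) 1, ∀ x y : TorusSite 2 L, ‖Hd j t ![(((omega0 M, y), 0), 0), ((((omega0 M).rev, Qm - y), 1), 0), ((((omega0 M).rev, Qm - x), 1), 1), (((omega0 M, x), 0), 1)]‖ ≤ RH₁ x y) ∧ (∀ t ∈ Icc (0 : ℝ) 1, ∀ x y : TorusSite 2 L, ‖Hd j' t ![(((omega0 M, y), 0), 0), ((((omega0 M).rev, Qm - y), 1), 0), ((((omega0 M).rev, Qm - x), 1), 1), (((omega0 M, x), 0), 1)]‖ ≤ RH₂ x y) ∧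
        (∀ t ∈ Icc (0 : ℝ) 1, ∀ x y : TorusSite 2 L, ‖Hd j t ![(((omega0 M, y), 0), 0), ((((omega0 M).rev, Qm - y), 1), 0), ((((omega0 M).rev, Qm - x), 1), 1), (((omega0 M, x), 0), 1)] - Hd j' t ![(((omega0 M, y), 0), 0), ((((omega0 M).rev, Qm - y), 1), 0), ((((omega0 M).rev, Qm - x), 1), 1), (((omega0 M, x), 0), 1)]‖ ≤ Rhd x y) ∧
        (∀ t ∈ Icc (0 : ℝ) 1, ∀ x y : TorusSite 2 L, (∑ p : FreqMomentum L M, ∑ _σ : Fin 2, ‖(((((Wd t p) : ℝ) : ℂ) * (((β * (L : ℝ) ^ 2 : ℝ) : ℂ) * propCT L M β μ (klFlowFrameU L M β U μ (n + 1)) p)) * ((((Φ j t p) : ℝ) : ℂ) * (((β * (L : ℝ) ^ 2 : ℝ) : ℂ) * propCT L M β μ (klFlowFrameU L M β U μ (n + 1)) p)))‖) ≤ W6₁ x y) ∧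
        (∀ t ∈ Icc (0 : ℝ) 1, ∀ x y : TorusSite 2 L, (∑ p : FreqMomentum L M, ∑ _σ : Fin 2, ‖(((((Wd t p) : ℝ) : ℂ) * (((β * (L : ℝ) ^ 2 : ℝ) : ℂ) * propCT L M β μ (klFlowFrameU L M β U μ (n + 1)) p)) * ((((Φ j' t p) : ℝ) : ℂ) * (((β * (L : ℝ) ^ 2 : ℝ) : ℂ) * propCT L M β μ (klFlowFrameU L M β U μ (n + 1)) p)))‖) ≤ W6₂ x y) ∧
        (∀ t ∈ Icc (0 : ℝ) 1, ∀ x y : TorusSite 2 L, (∑ p : FreqMomentum L M, ∑ _σ : Fin 2, ∑ p' : FreqMomentum L M, if matsubaraInt M p'.1 + matsubaraInt M (omega0 M) = matsubaraInt M p.1 + matsubaraInt M (omega0 M) ∧ p'.2 = p.2 + x - y then ‖((((((((softSymbolCompl L M β μ (klFlowFrameU L M β U μ (n + 1)) (n + 1) j) p - (softSymbolCompl L M β μ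
                    (klFlowFrameU L M β U μ (n + 1)) (n + 1) j') p)) : ℝ) : ℂ) * (((β * (L : ℝ) ^ 2 : ℝ) : ℂ) * propCT L M β μ (klFlowFrameU L M β U μ (n + 1)) p)) * ((((Wd t p') : ℝ) : ℂ) * (((β * (L : ℝ) ^ 2 : ℝ) : ℂ) * propCT L M β μ
                    (klFlowFrameU L M β U μ (n + 1)) p'))) + (((((Wd t p) : ℝ) : ℂ) * (((β * (L : ℝ) ^ 2 : ℝ) : ℂ) * propCT L M β μ (klFlowFrameU L M β U μ (n + 1)) p)) * ((((((softSymbolCompl L M β μ (klFlowFrameU L M β U μ (n + 1)) (n + 1) j) p' -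
                    (softSymbolCompl L M β μ (klFlowFrameU L M β U μ (n + 1)) (n + 1) j') p')) : ℝ) : ℂ) * (((β * (L : ℝ) ^ 2 : ℝ) : ℂ) * propCT L M β μ (klFlowFrameU L M β U μ (n + 1)) p'))))‖ else 0) ≤ WD₁ x y) ∧ (∀ t ∈ Icc (0 : ℝ) 1, ∀ x y : TorusSite 2 L, (∑ p : FreqMomentum L M, ∑ p' : FreqMomentum L M,
            if matsubaraInt M p'.1 + matsubaraInt M (omega0 M) + matsubaraInt M (omega0 M) + 1 = matsubaraInt M p.1 ∧ p'.2 = p.2 + Qm - x - y then ‖((((((((softSymbolCompl L M β μ (klFlowFrameU L M β U μ (n + 1)) (n + 1) j) p - (softSymbolCompl L M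
                    β μ (klFlowFrameU L M β U μ (n + 1)) (n + 1) j') p)) : ℝ) : ℂ) * (((β * (L : ℝ) ^ 2 : ℝ) : ℂ) * propCT L M β μ (klFlowFrameU L M β U μ (n + 1)) p)) * ((((Wd t p') : ℝ) : ℂ) * (((β * (L : ℝ) ^ 2 : ℝ) : ℂ) * propCT L M β μ
                    (klFlowFrameU L M β U μ (n + 1)) p'))) + (((((Wd t p) : ℝ) : ℂ) * (((β * (L : ℝ) ^ 2 : ℝ) : ℂ) * propCT L M β μ (klFlowFrameU L M β U μ (n + 1)) p)) * ((((((softSymbolCompl L M β μ (klFlowFrameU L M β U μ (n + 1)) (n + 1) j) p' -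
                    (softSymbolCompl L M β μ (klFlowFrameU L M β U μ (n + 1)) (n + 1) j') p')) : ℝ) : ℂ) * (((β * (L : ℝ) ^ 2 : ℝ) : ℂ) * propCT L M β μ (klFlowFrameU L M β U μ (n + 1)) p'))))‖ else 0) ≤ WD₂ x y) ∧
        (∀ t ∈ Icc (0 : ℝ) 1, ∀ x y : TorusSite 2 L, (∑ p : FreqMomentum L M, ∑ _σ : Fin 2, ‖(((((Wd t p) : ℝ) : ℂ) * (((β * (L : ℝ) ^ 2 : ℝ) : ℂ) * propCT L M β μ (klFlowFrameU L M β U μ (n + 1)) p)) * ((((((softSymbolCompl L M β μ (klFlowFrameU L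
                M β U μ (n + 1)) (n + 1) j) p - (softSymbolCompl L M β μ (klFlowFrameU L M β U μ (n + 1)) (n + 1) j') p)) : ℝ) : ℂ) * (((β * (L : ℝ) ^ 2 : ℝ) : ℂ) * propCT L M β μ (klFlowFrameU L M β U μ (n + 1)) p)))‖) ≤ WD₃ x y) ∧ (∀ t ∈ Icc (0 : ℝ) 1, ∀ x y : TorusSite 2 L, ‖∑ z : TorusSite 2 L × MatsubaraIdx M, Br j Qm t z * ((if z.1 ∈ klBall L μ 0 then
              V j t ![(((omega0 M, z.1), 0), 0), ((((omega0 M).rev, Qm - z.1), 1), 0), ((((omega0 M).rev, Qm - x), 1), 1), (((omega0 M, x), 0), 1)] * V j t ![(((omega0 M, y), 0), 0), ((((omega0 M).rev, Qm - y), 1), 0), ((((omega0 M).rev, Qm - z.1), 1), 1), (((omega0 M, z.1), 0), 1)] else 0) - V j t ![(((z.2, z.1), 0), 0), (((z.2.rev, Qm - z.1), 1), 0), ((((omega0 M).rev, Qm - x), 1), 1), (((omega0 M, x), 0), 1)] *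
              V j t ![(((omega0 M, y), 0), 0), ((((omega0 M).rev, Qm - y), 1), 0), (((z.2.rev, Qm - z.1), 1), 1), (((z.2, z.1), 0), 1)])‖ ≤ RL₁ x y) ∧ (∀ t ∈ Icc (0 : ℝ) 1, ∀ x y : TorusSite 2 L, ‖∑ z : TorusSite 2 L × MatsubaraIdx M, Br j' Qm t z * ((if z.1 ∈ klBall L μ 0 then V j' t ![(((omega0 M, z.1), 0), 0), ((((omega0 M).rev, Qm - z.1), 1), 0), ((((omega0 M).rev, Qm - x), 1), 1), (((omega0 M, x), 0), 1)] *
                V j' t ![(((omega0 M, y), 0), 0), ((((omega0 M).rev, Qm - y), 1), 0), ((((omega0 M).rev, Qm - z.1), 1), 1), (((omega0 M, z.1), 0), 1)] else 0) - V j' t ![(((z.2, z.1), 0), 0), (((z.2.rev, Qm - z.1), 1), 0), ((((omega0 M).rev, Qm - x), 1), 1), (((omega0 M, x), 0), 1)] *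
              V j' t ![(((omega0 M, y), 0), 0), ((((omega0 M).rev, Qm - y), 1), 0), (((z.2.rev, Qm - z.1), 1), 1), (((z.2, z.1), 0), 1)])‖ ≤ RL₂ x y) ∧ (∀ t ∈ Icc (0 : ℝ) 1, ∀ x y : TorusSite 2 L, ‖∑ z : TorusSite 2 L × MatsubaraIdx M, (fun z : TorusSite 2 L × MatsubaraIdx M => -(((((β * (L : ℝ) ^ 2 : ℝ) : ℂ)))⁻¹ * propCT L M β μ (klFlowFrameU L M β U μ (n + 1)) (z.2, z.1) * propCT L M β μ
                (klFlowFrameU L M β U μ (n + 1)) (z.2.rev, Qm - z.1)) * ((((klScale klE0 (n + 1) - klScale klE0 n) * (-Wd t (z.2, z.1) * ((softSymbolCompl L M β μ (klFlowFrameU L M β U μ (n + 1)) (n + 1) j) (z.2.rev, Qm - z.1) - (softSymbolCompl L M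
                β μ (klFlowFrameU L M β U μ (n + 1)) (n + 1) j') (z.2.rev, Qm - z.1)) - ((softSymbolCompl L M β μ (klFlowFrameU L M β U μ (n + 1)) (n + 1) j) (z.2, z.1) - (softSymbolCompl L M β μ (klFlowFrameU L M β U μ (n + 1)) (n + 1) j') (z.2, z.1)) * Wd t (z.2.rev, Qm - z.1))) : ℝ) : ℂ)) z * ((if z.1 ∈ klBall L μ 0 then
              V j t ![(((omega0 M, z.1), 0), 0), ((((omega0 M).rev, Qm - z.1), 1), 0), ((((omega0 M).rev, Qm - x), 1), 1), (((omega0 M, x), 0), 1)] * V j t ![(((omega0 M, y), 0), 0), ((((omega0 M).rev, Qm - y), 1), 0), ((((omega0 M).rev, Qm - z.1), 1), 1), (((omega0 M, z.1), 0), 1)] else 0) - V j t ![(((z.2, z.1), 0), 0), (((z.2.rev, Qm - z.1), 1), 0), ((((omega0 M).rev, Qm - x), 1), 1), (((omega0 M, x), 0), 1)] *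
              V j t ![(((omega0 M, y), 0), 0), ((((omega0 M).rev, Qm - y), 1), 0), (((z.2.rev, Qm - z.1), 1), 1), (((z.2, z.1), 0), 1)])‖ ≤ Rl₁ x y) ∧ (∀ t ∈ Icc (0 : ℝ) 1, ∀ x y : TorusSite 2 L, ‖∑ z : TorusSite 2 L × MatsubaraIdx M, Br j' Qm t z * (((if z.1 ∈ klBall L μ 0 then V j t ![(((omega0 M, z.1), 0), 0), ((((omega0 M).rev, Qm - z.1), 1), 0), ((((omega0 M).rev, Qm - x), 1), 1), (((omega0 M, x), 0), 1)] *
                V j t ![(((omega0 M, y), 0), 0), ((((omega0 M).rev, Qm - y), 1), 0), ((((omega0 M).rev, Qm - z.1), 1), 1), (((omega0 M, z.1), 0), 1)] else 0) - V j t ![(((z.2, z.1), 0), 0), (((z.2.rev, Qm - z.1), 1), 0), ((((omega0 M).rev, Qm - x), 1), 1), (((omega0 M, x), 0), 1)] * V j t ![(((omega0 M, y), 0), 0), ((((omega0 M).rev, Qm - y), 1), 0), (((z.2.rev, Qm - z.1), 1), 1), (((z.2, z.1), 0), 1)]) -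
            ((if z.1 ∈ klBall L μ 0 then V j' t ![(((omega0 M, z.1), 0), 0), ((((omega0 M).rev, Qm - z.1), 1), 0), ((((omega0 M).rev, Qm - x), 1), 1), (((omega0 M, x), 0), 1)] * V j' t ![(((omega0 M, y), 0), 0), ((((omega0 M).rev, Qm - y), 1), 0), ((((omega0 M).rev, Qm - z.1), 1), 1), (((omega0 M, z.1), 0), 1)] else 0) -
            V j' t ![(((z.2, z.1), 0), 0), (((z.2.rev, Qm - z.1), 1), 0), ((((omega0 M).rev, Qm - x), 1), 1), (((omega0 M, x), 0), 1)] * V j' t ![(((omega0 M, y), 0), 0), ((((omega0 M).rev, Qm - y), 1), 0), (((z.2.rev, Qm - z.1), 1), 1), (((z.2, z.1), 0), 1)]))‖ ≤ Rl₂ x y) ∧ (∀ x y, ‖klMemberArrayF L M β U μ n (softSymbolCompl L M β μ (klFlowFrameU L M β U μ n) n j) Qm x y‖ ≤ mA U) ∧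
        -- (F)(i) [k3c2-p2]: majorants of the FRAME SHIFT `K_n → K_(n+1)` of the history members / relative weight (model objects)
        (∀ x y, ‖(((Matrix.of fun k k' : TorusSite 2 L => if k ∈ klBall L μ 0 ∧ k' ∈ klBall L μ 0 then klCovSmearedPairAmplitude L M β U μ (klFlowFrameU L M β U μ (n + 1)) n (softCovOf L M β μ (klFlowFrameU L M β U μ (n + 1)) (softSymbolCompl L M β μ (klFlowFrameU L M β U μ (n + 1)) n j)) Qm k k' else 0) - klMemberArrayF L M β U μ n (softSymbolCompl L M β μ (klFlowFrameU L M β U μ n) n j) Qm) -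
          ((Matrix.of fun k k' : TorusSite 2 L => if k ∈ klBall L μ 0 ∧ k' ∈ klBall L μ 0 then klCovSmearedPairAmplitude L M β U μ (klFlowFrameU L M β U μ (n + 1)) n (softCovOf L M β μ (klFlowFrameU L M β U μ (n + 1)) (softSymbolCompl L M β μ (klFlowFrameU L M β U μ (n + 1)) n j')) Qm k k' else 0) - klMemberArrayF L M β U μ n (softSymbolCompl L M β μ (klFlowFrameU L M β U μ n) n j') Qm)) x y‖ ≤ ηr x y) ∧
        (∀ x y, ‖((Matrix.of fun k k' : TorusSite 2 L => if k ∈ klBall L μ 0 ∧ k' ∈ klBall L μ 0 then klCovSmearedPairAmplitude L M β U μ (klFlowFrameU L M β U μ (n + 1)) n (softCovOf L M β μ (klFlowFrameU L M β U μ (n + 1)) (softSymbolCompl L M β μ (klFlowFrameU L M β U μ (n + 1)) n j)) Qm k k' else 0) - klMemberArrayF L M β U μ n (softSymbolCompl L M β μ (klFlowFrameU L M β U μ n) n j) Qm) x y‖ ≤ η₁ x y) ∧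
        (∀ x y, ‖((Matrix.of fun k k' : TorusSite 2 L => if k ∈ klBall L μ 0 ∧ k' ∈ klBall L μ 0 then klCovSmearedPairAmplitude L M β U μ (klFlowFrameU L M β U μ (n + 1)) n (softCovOf L M β μ (klFlowFrameU L M β U μ (n + 1)) (softSymbolCompl L M β μ (klFlowFrameU L M β U μ (n + 1)) n j')) Qm k k' else 0) - klMemberArrayF L M β U μ n (softSymbolCompl L M β μ (klFlowFrameU L M β U μ n) n j') Qm) x y‖ ≤ η₂ x y) ∧
        (∀ c, ‖(fun p => -(((klTransferWeight L M β μ (klFlowFrameU L M β U μ (n + 1)) n (softSymbolCompl L M β μ (klFlowFrameU L M β U μ (n + 1)) n j) Qm p - klTransferWeight L M β μ (klFlowFrameU L M β U μ (n + 1)) n (softSymbolCompl L M β μ (klFlowFrameU L M β U μ (n + 1)) n j') Qm p : ℝ)) : ℂ)) c -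
          (-(((klTransferWeight L M β μ (klFlowFrameU L M β U μ n) n (softSymbolCompl L M β μ (klFlowFrameU L M β U μ n) n j) Qm c - klTransferWeight L M β μ (klFlowFrameU L M β U μ n) n (softSymbolCompl L M β μ (klFlowFrameU L M β U μ n) n j') Qm c : ℝ)) : ℂ))‖ ≤ d c) ∧
        (∀ x y, (ηr x y + mA U * ∑ c, η₁ x c * (d c + ‖(-(((klTransferWeight L M β μ (klFlowFrameU L M β U μ n) n (softSymbolCompl L M β μ (klFlowFrameU L M β U μ n) n j) Qm c - klTransferWeight L M β μ (klFlowFrameU L M β U μ n) n (softSymbolCompl L M β μ (klFlowFrameU L M β U μ n) n j') Qm c : ℝ)) : ℂ))‖) + mA U * mA U * ∑ c, d c + mA U * ∑ c, ‖(-(((klTransferWeight L M β μ (klFlowFrameU L M β U μ n) n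
                    (softSymbolCompl L M β μ (klFlowFrameU L M β U μ n) n j) Qm c - klTransferWeight L M β μ (klFlowFrameU L M β U μ n) n (softSymbolCompl L M β μ (klFlowFrameU L M β U μ n) n j') Qm c : ℝ)) : ℂ))‖ * η₂ c y) ≤ R₀ x y) ∧
        -- the analytic majorant `Ran`: re-frame part + D-classes at `(x,y)` + per member [remaining classes convolved against the MODEL profile `α(c)` written out] + M4²·(CONVOLVED PH
        -- masses DISCHARGED: flat at `n = 0`, two-shell convolution at `n ≥ 1`, with `Aw = (4·61524/π)·4^{−(j′−(n+1))}`, `Z = Aw·π` WRITTEN OUT — numbers only)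
        (∀ x y, R₀ x y +
            (((klScale klE0 n - klScale klE0 (n + 1)) * (2⁻¹ * Rhd x y + ((β * (L : ℝ) ^ 2) ^ 3)⁻¹ * ((if 1 ≤ n ∧ j' = n + 1 ∧ (4 + 8 / 3 * R.Gfr 1 * U ^ 2) * klTorusNorm L (x - y) < klScale klE0 (n + 1) / 8 then ((P.Klam * U) ^ 2 * (zD * ((4 : ℝ) ^ (n + 1))⁻¹ + hD * ((4 : ℝ) ^ (nScales β - n))⁻¹ + wD * ((2 : ℝ) ^ n)⁻¹ + lD * ((L : ℝ))⁻¹ + tD * min (klTorusNorm L (x - y) / klScale klE0 (n + 1)) (klScale klE0 (n + 1) / klTorusNorm L (x - y)))) / ((klScale klE0 n - klScale klE0 (n + 1)) * ((β * (L : ℝ) ^ 2) ^ 3)⁻¹) else M4 * M4 * WD₁ x y) + (η4 * M4 + M4 * η4) * ((if n = 0 then (2048 * 15367 : ℝ) else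
                  if (4 + 8 / 3 * R.Gfr 1 * U ^ 2) * klTorusNorm L (x - y) < klScale klE0 (n + 1) / 8 then (2048 * 15367 : ℝ) else 512 / 3 * (27 / (8 * Real.pi ^ 2)) * A2s * (16 / Real.pi) * (10 + 50 * (4 + 8 / 3 * R.Gfr 1 * U ^ 2) * β / L) *
                      (16384 * (4 + 8 / 3 * R.Gfr 1 * U ^ 2) ^ 2 * min (klTorusNorm L (x - y) / klScale klE0 (n + 1)) (klScale klE0 (n + 1) / klTorusNorm L (x - y)) + Real.sqrt 2 / 4 * ((2 : ℝ) ^ n)⁻¹)) /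
                ((klScale klE0 n - klScale klE0 (n + 1)) * ((β * (L : ℝ) ^ 2) ^ 3)⁻¹)) + (if 1 ≤ n ∧ j' = n + 1 ∧ n + 3 ≤ nScales β ∧ (4 + 8 / 3 * R.Gfr 1 * U ^ 2) * klTorusNorm L (x + y - Qm) < klScale klE0 (n + 1) / 16 then ((P.Klam * U) ^ 2 * (zX * ((4 : ℝ) ^ (n + 1))⁻¹ + hX * ((4 : ℝ) ^ (nScales β - n))⁻¹ + wX * ((2 : ℝ) ^ n)⁻¹ + lX * ((L : ℝ))⁻¹ + tX * min (klTorusNorm L (x + y - Qm) / klScale klE0 (n + 1)) (klScale klE0 (n + 1) / klTorusNorm L (x + y - Qm)))) / ((klScale klE0 n - klScale klE0 (n + 1)) * ((β * (L : ℝ) ^ 2) ^ 3)⁻¹) else M4 * M4 * WD₂ x y) + (η4 * M4 + M4 * η4) * ((if n = 0 then (1024 * 15367 : ℝ) else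
                  if (4 + 8 / 3 * R.Gfr 1 * U ^ 2) * klTorusNorm L (x + y - Qm) < klScale klE0 (n + 1) / 8 then (1024 * 15367 : ℝ) else 256 / 3 * (27 / (8 * Real.pi ^ 2)) * A2s * (16 / Real.pi) * (10 + 50 * (4 + 8 / 3 * R.Gfr 1 * U ^ 2) * β / L) *
                      (16384 * (4 + 8 / 3 * R.Gfr 1 * U ^ 2) ^ 2 * min (klTorusNorm L (x + y - Qm) / klScale klE0 (n + 1)) (klScale klE0 (n + 1) / klTorusNorm L (x + y - Qm)) + Real.sqrt 2 / 4 * ((2 : ℝ) ^ n)⁻¹)) / ((klScale klE0 n - klScale klE0 (n + 1)) * ((β * (L : ℝ) ^ 2) ^ 3)⁻¹)) + 2 * ((if 1 ≤ n ∧ j' = n + 1 then ((P.Klam * U) ^ 2 * bP * ((4 : ℝ) ^ (n + 1))⁻¹) / ((klScale klE0 n - klScale klE0 (n + 1)) * ((β * (L : ℝ) ^ 2) ^ 3)⁻¹) else M6 * M2 * WD₃ x y) + (η6 * M2 + M6 * η2) * W6₂ x y))) + (Rl₁ x y + Rl₂ x y)) +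
              mA U * (∑ c, ((klScale klE0 n - klScale klE0 (n + 1)) * (2⁻¹ * RH₁ x c + ((β * (L : ℝ) ^ 2) ^ 3)⁻¹ * (2 * (M6 * M2 * W6₁ x c))) + RL₁ x c) *
                (|klTransferWeight L M β μ (klFlowFrameU L M β U μ (n + 1)) (n + 1) (softSymbolCompl L M β μ (klFlowFrameU L M β U μ (n + 1)) (n + 1) j) Qm c - klTransferWeight L M β μ (klFlowFrameU L M β U μ (n + 1)) (n + 1) (softSymbolCompl L M β μ (klFlowFrameU L M β U μ (n + 1)) (n + 1) j') Qm c| +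
                  (klBubbleMaj L M β μ (klFlowFrameU L M β U μ (n + 1)) (fun k => (softSymbolCompl L M β μ (klFlowFrameU L M β U μ (n + 1)) (n + 1) j) k - (softSymbolCompl L M β μ (klFlowFrameU L M β U μ (n + 1)) (n + 1) j') k) (softSymbolCompl L M β μ (klFlowFrameU L M β U μ (n + 1)) n (n + 1)) Qm c +
                    klBubbleMaj L M β μ (klFlowFrameU L M β U μ (n + 1)) (softSymbolCompl L M β μ (klFlowFrameU L M β U μ (n + 1)) n (n + 1)) (fun k => (softSymbolCompl L M β μ (klFlowFrameU L M β U μ (n + 1)) (n + 1) j) k - (softSymbolCompl L M β μ (klFlowFrameU L M β U μ (n + 1)) (n + 1) j') k) Qm c)) + M4 * M4 * (if n = 0 then (2048 * 15367 : ℝ) * (4 * 61524 / Real.pi * ((4 : ℝ) ^ (j' - (n + 1)))⁻¹ * Real.pi) else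
                  (2048 * 15367 : ℝ) * (4 * 61524 / Real.pi * ((4 : ℝ) ^ (j' - (n + 1)))⁻¹) * klScale klE0 (n + 1) + 512 / 3 * ((27 / (8 * Real.pi ^ 2)) * A2s * (16 / Real.pi) * (10 + 50 * (4 + 8 / 3 * R.Gfr 1 * U ^ 2) * β / L)) * (Real.sqrt 2 / 4 * ((2 : ℝ) ^ n)⁻¹) * (4 * 61524 / Real.pi * ((4 : ℝ) ^ (j' - (n + 1)))⁻¹ * Real.pi) +
        2 * (4 * 61524 / Real.pi * ((4 : ℝ) ^ (j' - (n + 1)))⁻¹) * ((512 / 3 * ((27 / (8 * Real.pi ^ 2)) * A2s * (16 / Real.pi) * (10 + 50 * (4 + 8 / 3 * R.Gfr 1 * U ^ 2) * β / L)) * (16384 * (4 + 8 / 3 * R.Gfr 1 * U ^ 2) ^ 2) + (2048 * 15367 : ℝ) / (8 * (4 + 8 / 3 * R.Gfr 1 * U ^ 2))) * klScale klE0 (n + 1)) * Ish +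
        (512 / 3 * ((27 / (8 * Real.pi ^ 2)) * A2s * (16 / Real.pi) * (10 + 50 * (4 + 8 / 3 * R.Gfr 1 * U ^ 2) * β / L)) * (16384 * (4 + 8 / 3 * R.Gfr 1 * U ^ 2) ^ 2) + (2048 * 15367 : ℝ) / (8 * (4 + 8 / 3 * R.Gfr 1 * U ^ 2))) * klScale klE0 (n + 1) * (4 * 61524 / Real.pi * ((4 : ℝ) ^ (j' - (n + 1)))⁻¹ * Real.pi) / (klScale klE0 (n + 1) * 2 ^ Ish)) +
                M4 * M4 * (if n = 0 then (1024 * 15367 : ℝ) * (4 * 61524 / Real.pi * ((4 : ℝ) ^ (j' - (n + 1)))⁻¹ * Real.pi) else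
                  (1024 * 15367 : ℝ) * (4 * 61524 / Real.pi * ((4 : ℝ) ^ (j' - (n + 1)))⁻¹) * klScale klE0 (n + 1) + 256 / 3 * ((27 / (8 * Real.pi ^ 2)) * A2s * (16 / Real.pi) * (10 + 50 * (4 + 8 / 3 * R.Gfr 1 * U ^ 2) * β / L)) * (Real.sqrt 2 / 4 * ((2 : ℝ) ^ n)⁻¹) * (4 * 61524 / Real.pi * ((4 : ℝ) ^ (j' - (n + 1)))⁻¹ * Real.pi) +
        2 * (4 * 61524 / Real.pi * ((4 : ℝ) ^ (j' - (n + 1)))⁻¹) * ((256 / 3 * ((27 / (8 * Real.pi ^ 2)) * A2s * (16 / Real.pi) * (10 + 50 * (4 + 8 / 3 * R.Gfr 1 * U ^ 2) * β / L)) * (16384 * (4 + 8 / 3 * R.Gfr 1 * U ^ 2) ^ 2) + (1024 * 15367 : ℝ) / (8 * (4 + 8 / 3 * R.Gfr 1 * U ^ 2))) * klScale klE0 (n + 1)) * Ish +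
        (256 / 3 * ((27 / (8 * Real.pi ^ 2)) * A2s * (16 / Real.pi) * (10 + 50 * (4 + 8 / 3 * R.Gfr 1 * U ^ 2) * β / L)) * (16384 * (4 + 8 / 3 * R.Gfr 1 * U ^ 2) ^ 2) + (1024 * 15367 : ℝ) / (8 * (4 + 8 / 3 * R.Gfr 1 * U ^ 2))) * klScale klE0 (n + 1) * (4 * 61524 / Real.pi * ((4 : ℝ) ^ (j' - (n + 1)))⁻¹ * Real.pi) / (klScale klE0 (n + 1) * 2 ^ Ish))) +
              mA U * (∑ c, (|klTransferWeight L M β μ (klFlowFrameU L M β U μ (n + 1)) (n + 1) (softSymbolCompl L M β μ (klFlowFrameU L M β U μ (n + 1)) (n + 1) j) Qm c - klTransferWeight L M β μ (klFlowFrameU L M β U μ (n + 1)) (n + 1) (softSymbolCompl L M β μ (klFlowFrameU L M β U μ (n + 1)) (n + 1) j') Qm c| +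
                  (klBubbleMaj L M β μ (klFlowFrameU L M β U μ (n + 1)) (fun k => (softSymbolCompl L M β μ (klFlowFrameU L M β U μ (n + 1)) (n + 1) j) k - (softSymbolCompl L M β μ (klFlowFrameU L M β U μ (n + 1)) (n + 1) j') k) (softSymbolCompl L M β μ (klFlowFrameU L M β U μ (n + 1)) n (n + 1)) Qm c +
                    klBubbleMaj L M β μ (klFlowFrameU L M β U μ (n + 1)) (softSymbolCompl L M β μ (klFlowFrameU L M β U μ (n + 1)) n (n + 1)) (fun k => (softSymbolCompl L M β μ (klFlowFrameU L M β U μ (n + 1)) (n + 1) j) k - (softSymbolCompl L M β μ (klFlowFrameU L M β U μ (n + 1)) (n + 1) j') k) Qm c)) * ((klScale klE0 n - klScale klE0 (n + 1)) * (2⁻¹ * RH₂ c y + ((β * (L : ℝ) ^ 2) ^ 3)⁻¹ * (2 * (M6 * M2 * W6₂ c y))) + RL₂ c y) +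
                M4 * M4 * (if n = 0 then (2048 * 15367 : ℝ) * (4 * 61524 / Real.pi * ((4 : ℝ) ^ (j' - (n + 1)))⁻¹ * Real.pi) else
                  (2048 * 15367 : ℝ) * (4 * 61524 / Real.pi * ((4 : ℝ) ^ (j' - (n + 1)))⁻¹) * klScale klE0 (n + 1) + 512 / 3 * ((27 / (8 * Real.pi ^ 2)) * A2s * (16 / Real.pi) * (10 + 50 * (4 + 8 / 3 * R.Gfr 1 * U ^ 2) * β / L)) * (Real.sqrt 2 / 4 * ((2 : ℝ) ^ n)⁻¹) * (4 * 61524 / Real.pi * ((4 : ℝ) ^ (j' - (n + 1)))⁻¹ * Real.pi) +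
        2 * (4 * 61524 / Real.pi * ((4 : ℝ) ^ (j' - (n + 1)))⁻¹) * ((512 / 3 * ((27 / (8 * Real.pi ^ 2)) * A2s * (16 / Real.pi) * (10 + 50 * (4 + 8 / 3 * R.Gfr 1 * U ^ 2) * β / L)) * (16384 * (4 + 8 / 3 * R.Gfr 1 * U ^ 2) ^ 2) + (2048 * 15367 : ℝ) / (8 * (4 + 8 / 3 * R.Gfr 1 * U ^ 2))) * klScale klE0 (n + 1)) * Ish +
        (512 / 3 * ((27 / (8 * Real.pi ^ 2)) * A2s * (16 / Real.pi) * (10 + 50 * (4 + 8 / 3 * R.Gfr 1 * U ^ 2) * β / L)) * (16384 * (4 + 8 / 3 * R.Gfr 1 * U ^ 2) ^ 2) + (2048 * 15367 : ℝ) / (8 * (4 + 8 / 3 * R.Gfr 1 * U ^ 2))) * klScale klE0 (n + 1) * (4 * 61524 / Real.pi * ((4 : ℝ) ^ (j' - (n + 1)))⁻¹ * Real.pi) / (klScale klE0 (n + 1) * 2 ^ Ish)) +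
                M4 * M4 * (if n = 0 then (1024 * 15367 : ℝ) * (4 * 61524 / Real.pi * ((4 : ℝ) ^ (j' - (n + 1)))⁻¹ * Real.pi) else
                  (1024 * 15367 : ℝ) * (4 * 61524 / Real.pi * ((4 : ℝ) ^ (j' - (n + 1)))⁻¹) * klScale klE0 (n + 1) + 256 / 3 * ((27 / (8 * Real.pi ^ 2)) * A2s * (16 / Real.pi) * (10 + 50 * (4 + 8 / 3 * R.Gfr 1 * U ^ 2) * β / L)) * (Real.sqrt 2 / 4 * ((2 : ℝ) ^ n)⁻¹) * (4 * 61524 / Real.pi * ((4 : ℝ) ^ (j' - (n + 1)))⁻¹ * Real.pi) +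
        2 * (4 * 61524 / Real.pi * ((4 : ℝ) ^ (j' - (n + 1)))⁻¹) * ((256 / 3 * ((27 / (8 * Real.pi ^ 2)) * A2s * (16 / Real.pi) * (10 + 50 * (4 + 8 / 3 * R.Gfr 1 * U ^ 2) * β / L)) * (16384 * (4 + 8 / 3 * R.Gfr 1 * U ^ 2) ^ 2) + (1024 * 15367 : ℝ) / (8 * (4 + 8 / 3 * R.Gfr 1 * U ^ 2))) * klScale klE0 (n + 1)) * Ish +
        (256 / 3 * ((27 / (8 * Real.pi ^ 2)) * A2s * (16 / Real.pi) * (10 + 50 * (4 + 8 / 3 * R.Gfr 1 * U ^ 2) * β / L)) * (16384 * (4 + 8 / 3 * R.Gfr 1 * U ^ 2) ^ 2) + (1024 * 15367 : ℝ) / (8 * (4 + 8 / 3 * R.Gfr 1 * U ^ 2))) * klScale klE0 (n + 1) * (4 * 61524 / Real.pi * ((4 : ℝ) ^ (j' - (n + 1)))⁻¹ * Real.pi) / (klScale klE0 (n + 1) * 2 ^ Ish)))) ≤ Ran x y) ∧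
        -- ITS budget: the four-term FT form of `Ran` against the frame slack of the inherited bar plus three fifths of the slice's ROOM
        (∀ k ∈ klBall L μ 0, ∀ k' ∈ klBall L μ 0, Ran k k' + ∑ c, Ran k c * ρ j' Qm c * (3 / 2 * mA U) + ∑ a', 3 / 2 * mA U * ρ j Qm a' * Ran a' k' + ∑ a', ∑ c, 3 / 2 * mA U * ρ j Qm a' * Ran a' c * ρ j' Qm c * (3 / 2 * mA U) ≤ θ * (((2 : ℝ) ^ (n + 2))⁻¹ * transferBarRelIdx L Gth P r β U n j' Qm k k' + 3 / 5 * (klIdxPrefactor r (n + 1) * ((P.Klam * U) ^ 2 *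
              ((min (klTorusNorm L (k - k') / klScale klE0 (n + 1)) (klScale klE0 (n + 1) / klTorusNorm L (k - k')) + min (klTorusNorm L (k + k' - Qm) / klScale klE0 (n + 1)) (klScale klE0 (n + 1) / klTorusNorm L (k + k' - Qm)) + ((2 : ℝ) ^ n)⁻¹ + 3 * ((L : ℝ))⁻¹) * klIdxMass n j' + ((4 : ℝ) ^ (n + 1))⁻¹ * klIdxOverlap (n + 1) j') +
            ((P.Klam * |U|) ^ 3 * ((2 : ℝ) ^ n)⁻¹ + 3 * thermalBar Gth P U β (n + 1)) * klIdxMass n j'))))) (hexport : G.WF → ∀ Q : EngConsts, Q₀.IsRaiseOf Q → ∀ cc : ℝ, 0 < cc → cc ≤ klEngC₃6 P R → ∀ μ ∈ klWindowC, ∀ U : ℝ, 0 < U → U ≤ klEngU₀10 P R cc → U ≤ u Q cc → ∀ β : ℝ, klBetaMin ≤ β → β ≤ Real.exp (cc / U ^ 2) → ∀ (L M : ℕ) [NeZero L] [NeZero M], klEngL₄ P R β U ≤ L → klEngM₃ β U L ≤ M →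
              ∀ n : ℕ, n ≤ nScales β + 1 → IsKLRegime U cc (-((n : ℕ) : ℤ)) → HistP klPredsV17F2 L M G P Q R β U μ 0 (n) → FrameOK R U (nScales β) μ (klFlowFrameU L M β U μ (n)) → (∀ j ≤ n, LevelsUExportMixedAt L M (klCU2 P R Q₀) P β U μ j) → ∀ j' : ℕ, n ≤ j' → j' ≤ nScales β + 1 → ∀ Qm : TorusSite 2 L, C L Qm n →
        ∀ x y, ‖klMemberArrayF L M β U μ n (softSymbolCompl L M β μ (klFlowFrameU L M β U μ n) n j') Qm x y‖ ≤ mA U) : G.WF → ∀ Q : EngConsts, Q₀.IsRaiseOf Q → ∀ cc : ℝ, 0 < cc → cc ≤ klEngC₃6 P R → ∀ μ ∈ klWindowC, ∀ U : ℝ, 0 < U → U ≤ klEngU₀10 P R cc → U ≤ u Q cc → ∀ β : ℝ, klBetaMin ≤ β → β ≤ Real.exp (cc / U ^ 2) → ∀ (L M : ℕ) [NeZero L] [NeZero M], klEngL₄ P R β U ≤ L → klEngM₃ β U L ≤ M →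
            ∀ n : ℕ, n ≤ nScales β + 1 → IsKLRegime U cc (-(n : ℤ)) → HistP klPredsV17F2 L M G P Q R β U μ 0 n → FrameOK R U (nScales β) μ (klFlowFrameU L M β U μ n) → (∀ j ≤ n, LevelsUExportMixedAt L M (klCU2 P R Q₀) P β U μ j) → ∀ m m' : ℕ, n ≤ m' → m' ≤ m → m ≤ nScales β + 1 → ∀ Qm : TorusSite 2 L, C L Qm n → ∃ N : Matrix (TorusSite 2 L) (TorusSite 2 L) ℂ,
      (1 - diagonal (fun p => ((klTransferWeight L M β μ (klFlowFrameU L M β U μ n) n (softSymbolCompl L M β μ (klFlowFrameU L M β U μ n) n m) Qm p - klTransferWeight L M β μ (klFlowFrameU L M β U μ n) n (softSymbolCompl L M β μ (klFlowFrameU L M β U μ n) n m') Qm p : ℝ) : ℂ)) * klMemberArrayF L M β U μ n (softSymbolCompl L M β μ (klFlowFrameU L M β U μ n) n m') Qm) * N = 1 ∧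
      N * (1 - diagonal (fun p => ((klTransferWeight L M β μ (klFlowFrameU L M β U μ n) n (softSymbolCompl L M β μ (klFlowFrameU L M β U μ n) n m) Qm p - klTransferWeight L M β μ (klFlowFrameU L M β U μ n) n (softSymbolCompl L M β μ (klFlowFrameU L M β U μ n) n m') Qm p : ℝ) : ℂ)) * klMemberArrayF L M β U μ n (softSymbolCompl L M β μ (klFlowFrameU L M β U μ n) n m') Qm) = 1 ∧ ∀ k ∈ klBall L μ 0, ∀ k' ∈ klBall L μ 0,
        ‖klMemberArrayF L M β U μ n (softSymbolCompl L M β μ (klFlowFrameU L M β U μ n) n m) Qm k k' - (klMemberArrayF L M β U μ n (softSymbolCompl L M β μ (klFlowFrameU L M β U μ n) n m') Qm * N) k k'‖ ≤ transferBarRelIdx L Gth P r β U n m' Qm k k' := by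
  refine pairTransferStep7_of_analytic_resolved_convW_pinned2_all C hC mA hR hCF hKl hr hθ0 hθ h0 hmA h2s hA2s hkit hbase ?_ hexport
  intro hG Q hQ cc hcc0 hcc μ hμ U hU hU10 hUu β hβ hβc L M iL iM hL hM n hn hreg hhist hK hlev
  have ⟨hUu2, hj'β, hGδ, hE0c⟩ := hkit hG Q hQ cc hcc0 hcc μ hμ U hU hU10 hUu β hβ hβc L M hL hM n hn hreg
  obtain ⟨hZ, hstep⟩ := hsucc hG Q hQ cc hcc0 hcc μ hμ U hU hU10 hUu β hβ hβc L M hL hM n hn hreg hhist hK hlev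
  refine ⟨hZ, fun A A' b b' a ρ V V6 Sg Hd Φ Wd Br hA hA' hb hb' ha hρ hV hV6 hSg hHd hΦ hWd hBr j j' h1 h2 h3 Qm hQm => ?_⟩
  have ⟨ηr, η₁, η₂, R₀, Ran, d, M4, M6, M2, η4, η6, η2, zD, hD, wD, lD, tD, zX, hX, wX, lX, tX, bP, Ish, RH₁, RH₂, Rhd, W6₁, W6₂, WD₁, WD₂, WD₃, RL₁, RL₂, Rl₁, Rl₂,
    hA₁, hA₂, hM40, hz0, hPD, hPX, hPB, hM4, hM4', hM6, hM6', hM2, hM2', hη4, hη6, hη2, hRH1, hRH2, hRhd, hW61, hW62, hWD1, hWD2, hWD3,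
    hRL1, hRL2, hRl1, hRl2, hHist, hηr, hη₁, hη₂, hd, hR₀, hRan, hbud⟩ :=
    hstep A A' b b' a ρ V V6 Sg Hd Φ Wd Br hA hA' hb hb' ha hρ hV hV6 hSg hHd hΦ hWd hBr j j' h1 h2 h3 Qm hQm
  have hβ0 : 0 < β := pos_of_klBetaMin_le hβ
  have hβL : β ≤ (L : ℝ) := le_of_klEngL₃_le (klEngL₃_le_of_klEngL₄_le hL)
  have hΛd : 0 < (klScale klE0 n - klScale klE0 (n + 1)) * ((β * (L : ℝ) ^ 2) ^ 3)⁻¹ := by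
    have hΛ : 0 < klScale klE0 n := by unfold klScale klE0; positivity
    have hL0 : (0 : ℝ) < L := Nat.cast_pos.2 (Nat.pos_of_ne_zero (NeZero.ne L))
    have hs : klScale klE0 (n + 1) = klScale klE0 n / 4 := klth_klScale_succ n
    exact mul_pos (by rw [hs]; linarith) (by positivity)
  -- the doors' rows speak the PINNED symbols `Φ`, `Wd`; the profile lemmas the literal ones
  subst hΦ hWd
  -- the two `(x,y)`-difference-channel PH mass rows as PROFILES IN THE TRANSFER (flat at `n = 0`)
  have hWd2 := fun t (ht : t ∈ Icc (0 : ℝ) 1) (x y : TorusSite 2 L) => (le_div_iff₀' hΛd).2 (klrc_if_bound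
    (Wd_member_row_flat_le (M := M) β μ (klFlowFrameU L M β U μ (n + 1)) hK hβ hβL n h1 ht x y) fun hn1 =>
    Wd_member_row_le_profile (M := M) β μ (klFlowFrameU L M β U μ (n + 1)) h2s hA2s hR hU hUu2 hμ hK hβ hβL n h1 hj'β ht hGδ (hE0c hn1) x y)
  have hWx2 := fun t (ht : t ∈ Icc (0 : ℝ) 1) (x y : TorusSite 2 L) => (le_div_iff₀' hΛd).2 (klrc_if_bound
    (Wx_member_row_flat_le (M := M) β μ (klFlowFrameU L M β U μ (n + 1)) hK hβ hβL n h1 ht Qm x y) fun hn1 =>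
    Wx_member_row_le_profile (M := M) β μ (klFlowFrameU L M β U μ (n + 1)) h2s hA2s hR hU hUu2 hμ hK hβ hβL n h1 hj'β ht hGδ (hE0c hn1) Qm x y)
  exact ⟨ηr, η₁, η₂, R₀, Ran, d, M4, M6, M2, η4, η6, η2, zD, hD, wD, lD, tD, zX, hX, wX, lX, tX, bP, Ish, RH₁, RH₂, Rhd, W6₁, _, _, W6₂, WD₁, WD₂, WD₃, RL₁, RL₂, Rl₁, Rl₂,
    hA₁, hA₂, hM40, hz0, hPD, hPX, hPB, hM4, hM4', hM6, hM6', hM2, hM2', hη4, hη6, hη2, hRH1, hRH2, hRhd, hW61, hWd2, hWx2, hW62, hWD1, hWD2, hWD3,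
    hRL1, hRL2, hRl1, hRl2, hHist, hηr, hη₁, hη₂, hd, hR₀, hRan, hbud⟩

end ProducerAll

end Summit.HubbardSuperconductivity.HubbardSuperconductivity.Theorems.KLRegimeSplit

end
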